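import Literature.AlgebraicGeometry.GroupSchemes.SubgroupSchemeModuliClosed
import HarnessLib

/-!
# Liu's functor of stable rank-`q` subgroup schemes is represented by a closed subscheme of any Hilbert scheme of `q` points

Layer `Literature/AlgebraicGeometry/GroupSchemes`, namespace `Literature.AlgebraicGeometry.GroupSchemes`.  ONE THEOREM (no
definition, no instance, no notation, no named fact, no `sorry`).  Cell `hodgecm-mathlib` (D-0151), programme P6 «MOD», GENERIC
ORGAN L5.3, file 3 of the road ★ `SubgroupSchemeFunctorOfPoints` (the functor `S_{Iw}` and the predicate
`IsStableSubgroupModuli`) → ★ `SubgroupSchemeModuliClosed` (the closed condition `E` on the base of any family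
`Ξ ∈ Hilb^q_{G/S}(H)`); B-p04 (g36); kit `F0/P6-kit/IwahoriLevel.desk` of A-p07 (g17).  Count-neutral Mathlib-side capital:
HC_CM is proved only modulo the 7 printed citations until rung 0 closes; nothing here bears on it.

[Liu2021] App. D p. 137 L7–11: the functor `S ↦ {O_𝔭-stable finite flat S-subgroups of u^*E_∞[𝔭] of rank q}` «is represented
by a … morphism `π : S_{K,Iw} → S_K` of schemes».  GENERIC HALF, final assembly: **if `(H, Ξ)` is a Hilbert scheme of `q`
points of the `S`-group scheme `G` (★ `IsHilbertSchemeOfPoints q G H Ξ`, Stacks 0B94), then the closed subscheme `M := V(E) ⊆ H`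
of ★ `exists_idealSheafData_le_ker_iff_comap_mem_stableSubgroupFunctorOfPoints`, with the restricted family `Θ := Ξ|_M`,
REPRESENTS the functor of `act`-stable closed subgroup schemes of rank `q`** — the classifying morphism of `I ∈ S_{Iw}(T)` is its
Hilbert classifying morphism, which factors uniquely through the closed immersion `M ↪ H`.  So `𝓜_{Iw} → H → S` exists and is a
closed immersion into the Hilbert scheme (proper over `S` when `H` is); what is NOT generic — the existence of `Hilb^q_{G/S}`
for `G → S` finite locally free, and Liu's «finite flat of degree `q + 1`» — stays with Row 5 of MOD-PLAN.

## References
* [Liu2021] Y. Liu, *Fourier–Jacobi cycles and arithmetic relative trace formula*, Camb. J. Math. 9 (2021), App. D p. 137 L7–11.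
* [StacksProject] The Stacks Project, Tag 0B94 (Hilbert functor of points), Tag 01QO (closed immersions).
* [MumfordFogartyKirwan1994] D. Mumford, J. Fogarty, F. Kirwan, *Geometric Invariant Theory*, 3rd ed. (1994), Ch. 6 §3 Prop. 6.16 (p. 126).
-/

noncomputable section

-- Mathlib's `Over`/pull-back API is stated across semireducible wrappers (as in the ★ `GroupSchemes/*` files).
set_option backward.isDefEq.respectTransparency false

open CategoryTheory CategoryTheory.Limits AlgebraicGeometry MonoidalCategory CartesianMonoidalCategory
open scoped MonObj

universe v u

namespace Literature.AlgebraicGeometry.GroupSchemes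

open Literature.AlgebraicGeometry.HilbertScheme

section Representability

variable {S : Scheme.{u}} {G H : Over S} [GrpObj G] {O : Type v} (act : O → (G ⟶ G)) (q : ℕ)
  (Ξ : (G ⊗ H).left.IdealSheafData)

/-- **LIU'S FUNCTOR IS REPRESENTED BY A CLOSED SUBSCHEME OF THE HILBERT SCHEME.**  If `(H, Ξ)` is a Hilbert scheme of `q`
points of `G/S` (★ `IsHilbertSchemeOfPoints q G H Ξ`), then for the ideal sheaf `E` of ★ `SubgroupSchemeModuliClosed` the closed subscheme
`M := V(E) ⊆ H` (over `S` through `H`) with the restricted family `Θ := Ξ|_M` REPRESENTS the functor of `act`-stable closed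
subgroup schemes of rank `q` (`IsStableSubgroupModuli q G act M Θ` of ★ `SubgroupSchemeFunctorOfPoints`): the classifying map
of a stable subgroup `I ∈ S_{Iw}(T)` is its Hilbert classifying map, which factors (uniquely, `M ↪ H` being a closed
immersion) through `M`.  In particular `M → H` is a closed immersion, so `M` is proper ∕ projective over `S` when `H` is.
[cite: Liu2021, Appendix D, p. 137 L7–11] [cite: StacksProject, Tag 0B94] [cite: MumfordFogartyKirwan1994, Ch. 6 §3 Prop. 6.16 (p. 126)] -/
theorem exists_isStableSubgroupModuli_of_isHilbertSchemeOfPoints (hH : IsHilbertSchemeOfPoints q G H Ξ) :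
    ∃ E : H.left.IdealSheafData,
      IsStableSubgroupModuli q G act (Over.mk (E.subschemeι ≫ H.hom))
        (Ξ.comap (G ◁ (Over.homMk (U := Over.mk (E.subschemeι ≫ H.hom)) (V := H) E.subschemeι rfl)).left) := by
  obtain ⟨E, hE⟩ := exists_idealSheafData_le_ker_iff_comap_mem_stableSubgroupFunctorOfPoints act q Ξ hH.mem
  refine ⟨E, ?_⟩
  -- the closed subscheme `M = V(E) ↪ H` over `S`
  let M : Over S := Over.mk (E.subschemeι ≫ H.hom)
  let ιM : M ⟶ H := Over.homMk (U := M) (V := H) E.subschemeι rfl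
  change IsStableSubgroupModuli q G act M (Ξ.comap (G ◁ ιM).left)
  refine ⟨?_, ?_⟩
  · -- the restricted family is a stable subgroup: `E ≤ ker (V(E) ↪ H) = E`
    apply (hE ιM).1
    change E ≤ E.subschemeι.ker
    rw [Scheme.IdealSheafData.ker_subschemeι]
  · intro T I hI
    -- the Hilbert classifying map `g` of `I` factors through `V(E)`
    let g : T ⟶ H := hH.lift T I hI.1
    have hg : Ξ.comap (G ◁ g).left = I := hH.comap_lift T I hI.1
    have hEg : E.subschemeι.ker ≤ g.left.ker := by
      rw [Scheme.IdealSheafData.ker_subschemeι]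
      exact (hE g).2 (by rw [hg]; exact hI)
    let g₀ : T.left ⟶ E.subscheme := IsClosedImmersion.lift E.subschemeι g.left hEg
    have hg₀ : g₀ ≫ E.subschemeι = g.left := IsClosedImmersion.lift_fac _ _ _
    have hw : g₀ ≫ M.hom = T.hom := by
      change g₀ ≫ E.subschemeι ≫ H.hom = T.hom
      rw [← Category.assoc, hg₀, Over.w g]
    let g' : T ⟶ M := Over.homMk (U := T) (V := M) g₀ hw
    have hfac : g' ≫ ιM = g := by
      ext : 1
      exact hg₀
    refine ⟨g', ?_, ?_⟩
    · -- `g'` classifies `I`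
      change (Ξ.comap (G ◁ ιM).left).comap (G ◁ g').left = I
      rw [← IsHilbertSchemeOfPoints.comap_whiskerLeft_comp, hfac, hg]
    · -- uniqueness: through the Hilbert scheme, `V(E) ↪ H` being a monomorphism
      intro g'' hg''
      change (Ξ.comap (G ◁ ιM).left).comap (G ◁ g'').left = I at hg''
      rw [← IsHilbertSchemeOfPoints.comap_whiskerLeft_comp] at hg''
      have h1 : g'' ≫ ιM = g := hH.eq_lift hI.1 hg''
      ext : 1
      rw [← cancel_mono E.subschemeι]
      change (g'' ≫ ιM).left = g₀ ≫ E.subschemeι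
      rw [h1, hg₀]

end Representability

end Literature.AlgebraicGeometry.GroupSchemes

end
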